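import Literature.AlgebraicGeometry.HodgeTheory.LefschetzOneOneCechIntegrality
import Literature.AlgebraicTopology.SingularHomology.CechToSingular
import Literature.AlgebraicTopology.SingularHomology.ExpCocycleWinding
import Literature.Algebra.Homology.DoubleComplexZigzag
import HarnessLib

/-!
# The integer Čech cocycle of an integral class, and the Čech integrality step WITH the class

`Literature.AlgebraicGeometry.HodgeTheory.CechCocycleIntegral` (Weil 1952 §3; Bott–Tu Thm. 15.8 with
Prop. 9.5) says: on a finite chart-convex cover `𝒰` of a compact manifold `M`, the Čech `2`-cocycle
`c` of a de Rham zigzag of a closed `2`-form `θ` with INTEGRAL class is cohomologous to an integer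
cocycle, `c − δa = n ∈ ℤ`. For the integral form of Lefschetz's theorem on `(1,1)`-classes one needs
to remember WHICH integral class the integer cocycle `n` represents: this file proves the refinement

  **`c − δa = b`, where the integer Čech cocycle `b` represents the given integral singular class
  `z` under the Čech-to-small map of `𝒰` with INTEGER coefficients**

(`exists_sub_cechδ_eq_intCech_of_complexify_eq_π`). The integer cocycle `b` is produced first, from
`z` alone, in the Čech–singular double complex of `𝒰` with coefficients `ℤ` (`exists_intCech_of_intCocycle`:
the chart-convex sets are contractible, so the comparison `cechSingularEquiv` with integer coefficients
is available, and its inverse is the Čech-to-small map `cechToSmall` of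
`AlgebraicTopology/SingularHomology/CechToSingular`; Čech `0`-cocycles of path-connected sets are
constants). The zigzag `εζ − ηb = DY` certifying this is then READ IN THE SMOOTH REAL double complex of the
tree's de Rham files through the values map `toSmoothReal` (integer cochains as smooth real cochains,
same values on smooth simplices: it commutes with all differentials), where it meets the de Rham
zigzag of `θ` (`cechSmoothSingularEquiv_intSmall_eq`) and the integration comparison
(`exists_singSmall_sub_intSmall_eq_dA`): both `(b)` and `(c)` represent the image of `[θ]`, so they
differ by a Čech coboundary of constants — with NO passage through real coefficients on the integer
side, hence no loss of torsion.

* `toSmoothReal`, `sEvalSimplex_toSmoothReal`, `toSmoothReal_cod`, `toSmoothReal_cres`,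
  `toSmoothRealTot_totalD` — the values map and its compatibilities;
* `exists_intCech_of_intCocycle` — the integer Čech cocycle `b` of an integer singular `2`-cocycle
  `ζ` on a chart-convex cover, with the collating zigzag and the quadruple cocycle identity;
* `exists_sub_cechδ_eq_intCech_of_integration_eq_π` (real core),
  `exists_sub_cechδ_eq_intCech_of_complexify_eq_π` (complex statement).

No named facts; everything is proved.

## References

* A. Weil, *Sur les théorèmes de de Rham*, Comment. Math. Helv. 26 (1952), §3.
* R. Bott, L. W. Tu, *Differential Forms in Algebraic Topology* (1982), Thm. 8.9, Prop. 9.5,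
  Thm. 15.8. [BottTu1982Forms]
* P. Griffiths, J. Harris, *Principles of Algebraic Geometry* (1978), pp. 139–141 (`c₁` as the
  Čech coboundary of `(1/2πi) log g`). [GriffithsHarris1978]
-/

noncomputable section

set_option backward.isDefEq.respectTransparency false

open scoped Manifold ContDiff Topology
open Set Filter Function
open Literature.Geometry.Kaehler hiding cechδ_apply cechd_apply cechδ cechd cechSet mem_cechSet_iff
open Literature.Geometry.Manifold
open Literature.NumberTheory.Transcendental
open Literature.Algebra.Homology
open Literature.AlgebraicTopology.SingularHomology hiding cechSet mem_cechSet_iff cechSet_subset_comp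
  cechSet_subset_apply cechSet_cons

namespace Literature.AlgebraicGeometry.HodgeTheory

/-- The coefficient module of the integer cochains of this file: `ULift ℤ` (the coefficient object of
the tree's comparison of the cochains of a subset with singular cochains). [folklore] -/
abbrev IntCoeff : Type := ULift.{0} ℤ

/-- The inclusion of `ℤ` in the coefficient module `ULift ℤ`. [folklore] -/
def intCoeffHom : ℤ →+ IntCoeff := AddEquiv.ulift.symm.toAddMonoidHom

/-- `intCoeffHom n = ⟨n⟩`. [folklore] -/
@[simp]
theorem intCoeffHom_apply (n : ℤ) : intCoeffHom n = ULift.up n := rfl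

/-! ### Integer cochains read as smooth real cochains -/

section Values

variable {E : Type} [NormedAddCommGroup E] [NormedSpace ℝ E] {M : Type} [TopologicalSpace M]
  [ChartedSpace E M]

/-- **The smooth cochain of `A` with prescribed values on smooth simplices.** [folklore] -/
def sCochainOfFun (A : Set M) (q : ℕ) (F : SingularSimplex M q → ℝ) : SCochainOn 𝓘(ℝ, E) ℝ ℝ A q where
  toFun x := Finsupp.linearCombination ℝ F x.1
  map_add' x y := map_add _ x.1 y.1
  map_smul' r x := map_smul _ r x.1

/-- The values of `sCochainOfFun A q F` on smooth simplices of `A`. [folklore] -/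
theorem sEvalSimplex_sCochainOfFun {A : Set M} {q : ℕ} (F : SingularSimplex M q → ℝ)
    {σ : SingularSimplex M q} (hσ : IsSmoothIn 𝓘(ℝ, E) A σ) :
    sEvalSimplex (sCochainOfFun (E := E) A q F) σ = F σ := by
  rw [sEvalSimplex_of_isSmoothIn _ hσ]
  change Finsupp.linearCombination ℝ F (Finsupp.single σ 1) = F σ
  rw [Finsupp.linearCombination_single, one_smul]

/-- **The values of a smooth coboundary**: `(δψ)(σ) = Σ_i (-1)^i ψ(σ ∘ δ_i)` for a smooth
`(q+1)`-simplex of `A`. [cite: Bredon1993, §V.9] -/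
theorem sEvalSimplex_scod {A : Set M} {q : ℕ} (ψ : SCochainOn 𝓘(ℝ, E) ℝ ℝ A q)
    {σ : SingularSimplex M (q + 1)} (hσ : IsSmoothIn 𝓘(ℝ, E) A σ) :
    sEvalSimplex (scod A q ψ) σ =
      ∑ i : Fin (q + 2), (-1 : ℝ) ^ (i : ℕ) • sEvalSimplex ψ (σ.face i) := by
  have hf : ∀ i : Fin (q + 2), IsSmoothIn 𝓘(ℝ, E) A (σ.face i) := fun i ↦
    ⟨hσ.1.face i, (SingularSimplex.range_face_subset i σ).trans hσ.2⟩
  rw [sEvalSimplex_of_isSmoothIn _ hσ, scod_apply]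
  have hd : ((((smoothChainsInSub 𝓘(ℝ, E) ℝ ℝ M A).toComplex.d (q + 1) q).hom (sElemChain hσ)) :
      (smoothChainsInSub 𝓘(ℝ, E) ℝ ℝ M A).toComplex.X q) =
      ∑ i : Fin (q + 2), (-1 : ℝ) ^ (i : ℕ) • sElemChain (R := ℝ) (hf i) := by
    apply Subtype.ext
    rw [toComplex_d_val, coe_sElemChain, csingularChainComplex.bd_single, Submodule.coe_sum]
    refine Finset.sum_congr rfl fun i _ ↦ ?_
    rw [Submodule.coe_smul, coe_sElemChain]
  rw [hd, map_sum]
  refine Finset.sum_congr rfl fun i _ ↦ ?_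
  rw [map_smul, sEvalSimplex_of_isSmoothIn _ (hf i)]

/-- **Integer cochains (coefficients `ULift ℤ`) read as smooth real cochains**: same values on the
smooth simplices. [folklore] -/
def toSmoothReal (A : Set M) (q : ℕ) (ψ : CochainOn ℤ IntCoeff A q) : SCochainOn 𝓘(ℝ, E) ℝ ℝ A q :=
  sCochainOfFun A q fun σ ↦ ((evalSimplex ψ σ).down : ℝ)

/-- The values of `toSmoothReal A q ψ`. [folklore] -/
theorem sEvalSimplex_toSmoothReal {A : Set M} {q : ℕ} (ψ : CochainOn ℤ IntCoeff A q)
    {σ : SingularSimplex M q} (hσ : IsSmoothIn 𝓘(ℝ, E) A σ) :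
    sEvalSimplex (toSmoothReal (E := E) A q ψ) σ = ((evalSimplex ψ σ).down : ℝ) :=
  sEvalSimplex_sCochainOfFun _ hσ

/-- `toSmoothReal` is additive. [folklore] -/
theorem toSmoothReal_add {A : Set M} {q : ℕ} (ψ ψ' : CochainOn ℤ IntCoeff A q) :
    toSmoothReal (E := E) A q (ψ + ψ') = toSmoothReal A q ψ + toSmoothReal A q ψ' := by
  refine ext_sEvalSimplex fun σ hσ ↦ ?_
  rw [sEvalSimplex_add, sEvalSimplex_toSmoothReal _ hσ, sEvalSimplex_toSmoothReal _ hσ,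
    sEvalSimplex_toSmoothReal _ hσ, evalSimplex_add, ULift.add_down, Int.cast_add]

/-- `toSmoothReal` of `0`. [folklore] -/
theorem toSmoothReal_zero (A : Set M) (q : ℕ) : toSmoothReal (E := E) A q 0 = 0 := by
  refine ext_sEvalSimplex fun σ hσ ↦ ?_
  rw [sEvalSimplex_toSmoothReal _ hσ, evalSimplex_of_subset _ hσ.2, LinearMap.zero_apply,
    sEvalSimplex_of_isSmoothIn _ hσ, LinearMap.zero_apply, ULift.zero_down, Int.cast_zero]

/-- `toSmoothReal` as an additive map. [folklore] -/
def toSmoothRealHom (A : Set M) (q : ℕ) : CochainOn ℤ IntCoeff A q →+ SCochainOn 𝓘(ℝ, E) ℝ ℝ A q where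
  toFun := toSmoothReal A q
  map_zero' := toSmoothReal_zero A q
  map_add' := toSmoothReal_add

/-- `toSmoothRealHom` is `toSmoothReal`. [folklore] -/
@[simp]
theorem toSmoothRealHom_apply (A : Set M) (q : ℕ) (ψ : CochainOn ℤ IntCoeff A q) :
    toSmoothRealHom (E := E) A q ψ = toSmoothReal A q ψ :=
  rfl

/-- `toSmoothReal` is compatible with negation. [folklore] -/
theorem toSmoothReal_neg {A : Set M} {q : ℕ} (ψ : CochainOn ℤ IntCoeff A q) :
    toSmoothReal (E := E) A q (-ψ) = -toSmoothReal A q ψ :=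
  (toSmoothRealHom (E := E) A q).map_neg ψ

/-- `toSmoothReal` is compatible with subtraction. [folklore] -/
theorem toSmoothReal_sub {A : Set M} {q : ℕ} (ψ ψ' : CochainOn ℤ IntCoeff A q) :
    toSmoothReal (E := E) A q (ψ - ψ') = toSmoothReal A q ψ - toSmoothReal A q ψ' :=
  (toSmoothRealHom (E := E) A q).map_sub ψ ψ'

/-- `toSmoothReal` is compatible with integer multiples. [folklore] -/
theorem toSmoothReal_zsmul {A : Set M} {q : ℕ} (k : ℤ) (ψ : CochainOn ℤ IntCoeff A q) :
    toSmoothReal (E := E) A q (k • ψ) = (k : ℝ) • toSmoothReal A q ψ := by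
  rw [Int.cast_smul_eq_zsmul ℝ k (toSmoothReal (E := E) A q ψ)]
  exact map_zsmul (toSmoothRealHom (E := E) A q) k ψ

/-- **`toSmoothReal` commutes with restriction.** [folklore] -/
theorem toSmoothReal_cres {A B : Set M} (h : A ⊆ B) {q : ℕ} (ψ : CochainOn ℤ IntCoeff B q) :
    toSmoothReal (E := E) A q (cres h q ψ) = scres h q (toSmoothReal B q ψ) := by
  refine ext_sEvalSimplex fun σ hσ ↦ ?_
  rw [sEvalSimplex_toSmoothReal _ hσ, sEvalSimplex_scres _ _ hσ, sEvalSimplex_toSmoothReal _ (hσ.mono h),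
    evalSimplex_cres _ _ hσ.2]

/-- `down` of a finite sum in `ULift ℤ`. [folklore] -/
theorem IntCoeff.down_sum {β : Type*} (s : Finset β) (f : β → IntCoeff) :
    (∑ i ∈ s, f i).down = ∑ i ∈ s, (f i).down := by
  classical
  induction s using Finset.induction_on with
  | empty => rfl
  | insert b s hb ih => rw [Finset.sum_insert hb, Finset.sum_insert hb, ULift.add_down, ih]

/-- **`toSmoothReal` commutes with the coboundaries.** [folklore] -/
theorem toSmoothReal_cod {A : Set M} {q : ℕ} (ψ : CochainOn ℤ IntCoeff A q) :
    toSmoothReal (E := E) A (q + 1) (cod A q ψ) = scod A q (toSmoothReal A q ψ) := by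
  refine ext_sEvalSimplex fun σ hσ ↦ ?_
  rw [sEvalSimplex_toSmoothReal _ hσ, sEvalSimplex_scod _ hσ, evalSimplex_cod _ hσ.2]
  have hdown : ((∑ i : Fin (q + 2), (-1 : ℤ) ^ (i : ℕ) • evalSimplex ψ (σ.face i)).down : ℝ) =
      ∑ i : Fin (q + 2), (-1 : ℝ) ^ (i : ℕ) • ((evalSimplex ψ (σ.face i)).down : ℝ) := by
    rw [IntCoeff.down_sum]
    push_cast
    refine Finset.sum_congr rfl fun i _ ↦ ?_
    rw [ULift.smul_down, zsmul_eq_mul, smul_eq_mul]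
    push_cast
    ring
  rw [hdown]
  refine Finset.sum_congr rfl fun i _ ↦ ?_
  rw [sEvalSimplex_toSmoothReal _ ⟨hσ.1.face i, (SingularSimplex.range_face_subset i σ).trans hσ.2⟩]

variable {ι : Type*} (U : ι → Set M)

/-- The values map on Čech cochains. [folklore] -/
def toSmoothRealCech (p q : ℕ) (c : CechCochain ℤ IntCoeff U p q) : CechSCochain 𝓘(ℝ, E) ℝ ℝ U p q :=
  fun J ↦ toSmoothReal _ q (c J)

/-- Components of `toSmoothRealCech`. [folklore] -/
@[simp]
theorem toSmoothRealCech_apply {p q : ℕ} (c : CechCochain ℤ IntCoeff U p q) (J : Fin (p + 1) → ι) :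
    toSmoothRealCech (E := E) U p q c J = toSmoothReal _ q (c J) :=
  rfl

/-- `toSmoothRealCech` is additive. [folklore] -/
theorem toSmoothRealCech_add {p q : ℕ} (c c' : CechCochain ℤ IntCoeff U p q) :
    toSmoothRealCech (E := E) U p q (c + c') = toSmoothRealCech U p q c + toSmoothRealCech U p q c' := by
  funext J
  exact toSmoothReal_add _ _

/-- `toSmoothRealCech` of `0`. [folklore] -/
theorem toSmoothRealCech_zero (p q : ℕ) : toSmoothRealCech (E := E) U p q 0 = 0 := by
  funext J
  exact toSmoothReal_zero _ _

/-- **`toSmoothRealCech` commutes with the Čech differentials.** [folklore] -/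
theorem toSmoothRealCech_cechδ {p q : ℕ} (c : CechCochain ℤ IntCoeff U p q) :
    toSmoothRealCech (E := E) U (p + 1) q (cechδ ℤ IntCoeff U p q c) =
      cechSδ 𝓘(ℝ, E) ℝ ℝ U p q (toSmoothRealCech U p q c) := by
  funext J
  rw [toSmoothRealCech_apply, Literature.AlgebraicTopology.SingularHomology.cechδ_apply, cechSδ_apply]
  refine ext_sEvalSimplex fun σ hσ ↦ ?_
  rw [sEvalSimplex_toSmoothReal _ hσ, evalSimplex_sum, sEvalSimplex_sum, IntCoeff.down_sum]
  push_cast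
  refine Finset.sum_congr rfl fun j _ ↦ ?_
  rw [evalSimplex_smul, sEvalSimplex_smul, evalSimplex_cres _ _ hσ.2, ULift.smul_down, zsmul_eq_mul,
    toSmoothRealCech_apply, sEvalSimplex_scres _ _ hσ, sEvalSimplex_toSmoothReal _
      (hσ.mono (Literature.AlgebraicTopology.SingularHomology.cechSet_subset_comp U J _)), smul_eq_mul]
  push_cast
  ring

/-- **`toSmoothRealCech` commutes with the vertical differentials.** [folklore] -/
theorem toSmoothRealCech_cechd {p q : ℕ} (c : CechCochain ℤ IntCoeff U p q) :
    toSmoothRealCech (E := E) U p (q + 1) (cechd ℤ IntCoeff U p q c) =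
      cechSd 𝓘(ℝ, E) ℝ ℝ U p q (toSmoothRealCech U p q c) := by
  funext J
  rw [toSmoothRealCech_apply, Literature.AlgebraicTopology.SingularHomology.cechd_apply, cechSd_apply,
    toSmoothReal_zsmul, toSmoothReal_cod, toSmoothRealCech_apply]
  push_cast
  rfl

/-- The values map on the big module of the double complex. [folklore] -/
def toSmoothRealTot (y : ∀ p q, CechCochain ℤ IntCoeff U p q) : ∀ p q, CechSCochain 𝓘(ℝ, E) ℝ ℝ U p q :=
  fun p q ↦ toSmoothRealCech U p q (y p q)

/-- Entries of `toSmoothRealTot`. [folklore] -/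
@[simp]
theorem toSmoothRealTot_apply (y : ∀ p q, CechCochain ℤ IntCoeff U p q) (p q : ℕ) :
    toSmoothRealTot (E := E) U y p q = toSmoothRealCech U p q (y p q) :=
  rfl

/-- `toSmoothRealTot` preserves homogeneity. [folklore] -/
theorem toSmoothRealTot_mem_Tn {n : ℕ} {y : ∀ p q, CechCochain ℤ IntCoeff U p q}
    (hy : y ∈ ADoubleComplex.Tn ℤ n) :
    toSmoothRealTot (E := E) U y ∈ ADoubleComplex.Tn ℝ (X := CechSCochain 𝓘(ℝ, E) ℝ ℝ U) n := by
  intro p q hpq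
  rw [toSmoothRealTot_apply, hy p q hpq, toSmoothRealCech_zero]

/-- `toSmoothRealTot` of a single entry. [folklore] -/
theorem toSmoothRealTot_single (p q : ℕ) (v : CechCochain ℤ IntCoeff U p q) :
    toSmoothRealTot (E := E) U (ADoubleComplex.single p q v) =
      ADoubleComplex.single p q (toSmoothRealCech U p q v) := by
  funext p' q'
  rw [toSmoothRealTot_apply]
  by_cases h : p' = p ∧ q' = q
  · obtain ⟨rfl, rfl⟩ := h
    rw [ADoubleComplex.single_apply_same, ADoubleComplex.single_apply_same]
  · rw [ADoubleComplex.single_apply_of_ne (not_and_or.1 h), ADoubleComplex.single_apply_of_ne (not_and_or.1 h),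
      toSmoothRealCech_zero]

/-- `toSmoothRealTot` is compatible with subtraction. [folklore] -/
theorem toSmoothRealTot_sub (y y' : ∀ p q, CechCochain ℤ IntCoeff U p q) :
    toSmoothRealTot (E := E) U (y - y') = toSmoothRealTot U y - toSmoothRealTot U y' := by
  funext p q J
  change toSmoothReal _ q (y p q J - y' p q J) = toSmoothReal _ q (y p q J) - toSmoothReal _ q (y' p q J)
  exact toSmoothReal_sub _ _

/-- **The values map commutes with the total differentials** of the integer Čech–singular double
complex and of the smooth real one. [cite: BottTu1982Forms, §8] -/
theorem toSmoothRealTot_totalD (y : ∀ p q, CechCochain ℤ IntCoeff U p q) :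
    toSmoothRealTot (E := E) U ((cechSingular ℤ IntCoeff U).totalD y) =
      (cechSmoothSingular 𝓘(ℝ, E) ℝ ℝ U).totalD (toSmoothRealTot U y) := by
  funext p q
  rw [toSmoothRealTot_apply, ADoubleComplex.totalD_apply, ADoubleComplex.totalD_apply, toSmoothRealCech_add]
  congr 1
  · cases p with
    | zero => rw [ADoubleComplex.hPart_apply_zero, ADoubleComplex.hPart_apply_zero, toSmoothRealCech_zero]
    | succ p =>
      rw [ADoubleComplex.hPart_apply_succ, ADoubleComplex.hPart_apply_succ, toSmoothRealTot_apply]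
      exact toSmoothRealCech_cechδ U (y p q)
  · cases q with
    | zero => rw [ADoubleComplex.vPart_apply_zero, ADoubleComplex.vPart_apply_zero, toSmoothRealCech_zero]
    | succ q =>
      rw [ADoubleComplex.vPart_apply_succ, ADoubleComplex.vPart_apply_succ, toSmoothRealTot_apply]
      exact toSmoothRealCech_cechd U (y p q)

end Values

/-! ### The integer Čech cocycle of an integer singular `2`-cocycle on a chart-convex cover -/

section IntSide

variable {E : Type} [NormedAddCommGroup E] [NormedSpace ℝ E] {M : Type} [TopologicalSpace M]
  [ChartedSpace E M] {ι : Type*}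

/-- **The integer cochain of an integer-valued function on `2`-simplices** (coefficients `ULift ℤ`),
on all of `M`. [folklore] -/
def intCochain (ζ : SingularSimplex M 2 → ℤ) : CochainOn ℤ IntCoeff (univ : Set M) 2 :=
  cochainOfFun univ 2 fun σ ↦ ULift.up (ζ σ)

/-- Values of `intCochain ζ`. [folklore] -/
theorem evalSimplex_intCochain (ζ : SingularSimplex M 2 → ℤ) (σ : SingularSimplex M 2) :
    evalSimplex (intCochain ζ) σ = ULift.up (ζ σ) :=
  evalSimplex_cochainOfFun _ (subset_univ _)

/-- `intCochain ζ` is a cocycle when `ζ` satisfies the cocycle identity. [folklore] -/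
theorem cod_intCochain (ζ : SingularSimplex M 2 → ℤ)
    (hζ : ∀ σ : SingularSimplex M 3, ∑ i : Fin 4, (-1 : ℤ) ^ (i : ℕ) * ζ (σ.face i) = 0) :
    cod univ 2 (intCochain ζ) = 0 := by
  refine ext_evalSimplex fun σ hσ ↦ ?_
  rw [evalSimplex_cod _ hσ, evalSimplex_of_subset _ hσ, LinearMap.zero_apply]
  apply ULift.ext
  rw [IntCoeff.down_sum]
  change ∑ i : Fin 4, ((-1 : ℤ) ^ (i : ℕ) • evalSimplex (intCochain ζ) (σ.face i)).down = 0
  simp only [evalSimplex_intCochain, ULift.smul_down, smul_eq_mul]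
  exact hζ σ

/-- **`0`-cocycles are constant along paths**: a `0`-cochain of `A` killed by the coboundary takes
the same value at the end points of any path in `A`. [folklore] -/
theorem evalSimplex_ofPoint_eq_of_joinedIn {R : Type*} [CommRing R] {N : Type*} [AddCommGroup N]
    [Module R N] {A : Set M} {ψ : CochainOn R N A 0} (hψ : cod A 0 ψ = 0) {x y : M}
    (h : JoinedIn A x y) :
    evalSimplex ψ (SingularSimplex.ofPoint x) = evalSimplex ψ (SingularSimplex.ofPoint y) := by
  obtain ⟨γ, hγ⟩ := h
  have hτ : (SingularSimplex.ofPath γ).range ⊆ A := by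
    rintro _ ⟨t, rfl⟩
    rw [SingularSimplex.ofPath_apply]
    exact hγ _
  have h0 := congrArg (fun φ ↦ evalSimplex φ (SingularSimplex.ofPath γ)) hψ
  rw [evalSimplex_cod _ hτ, Fin.sum_univ_two, SingularSimplex.ofPath_face_zero,
    SingularSimplex.ofPath_face_one, evalSimplex_of_subset (0 : CochainOn R N A 1) hτ,
    LinearMap.zero_apply] at h0
  simp only [Fin.val_zero, pow_zero, one_smul, Fin.val_one, pow_one, neg_smul, add_neg_eq_zero] at h0
  exact h0.symm

/-- A `0`-simplex with image in `A` gives a point of `A`. [folklore] -/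
theorem pt_mem_of_range_subset {A : Set M} {σ : SingularSimplex M 0} (hσ : σ.range ⊆ A) : σ.pt ∈ A :=
  hσ σ.pt_mem_range

variable (𝒰 : ChartConvexCover E M ι)

/-- **The finite intersections of a chart-convex cover are acyclic for INTEGER cochains**
(contractible or empty). [folklore] -/
theorem hacycInt (p q : ℕ) (J : Fin (p + 1) → ι)
    (ψ : CochainOn ℤ IntCoeff (Literature.AlgebraicTopology.SingularHomology.cechSet 𝒰.U J) (q + 1))
    (hψ : cod (Literature.AlgebraicTopology.SingularHomology.cechSet 𝒰.U J) (q + 1) ψ = 0) :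
    ∃ φ : CochainOn ℤ IntCoeff (Literature.AlgebraicTopology.SingularHomology.cechSet 𝒰.U J) q,
      cod (Literature.AlgebraicTopology.SingularHomology.cechSet 𝒰.U J) q φ = ψ := by
  rcases isEmptyOrChartSet_cechSet 𝒰 J with he | ⟨p', C, hCc, hCT, hJ⟩
  · exact exists_cod_eq_of_eq_empty he ψ
  · rcases C.eq_empty_or_nonempty with hC | hCne
    · have he : Literature.AlgebraicTopology.SingularHomology.cechSet 𝒰.U J = ∅ := by
        rw [hJ, hC]
        ext x
        simp [chartSet]
      exact exists_cod_eq_of_eq_empty he ψ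
    · have hCT' : C ⊆ (chartAt E p').target := by
        rw [extChartAt_self] at hCT
        exact hCT
      haveI : ContractibleSpace ↥(Literature.AlgebraicTopology.SingularHomology.cechSet 𝒰.U J) := by
        rw [hJ]
        exact contractibleSpace_chartSet p' hCc hCne hCT'
      exact exists_cod_eq_of_contractibleSpace (R := ℤ) _ ψ hψ

/-- **The integer Čech cocycle of an integer singular `2`-cocycle on a chart-convex cover.** For an
integer-valued singular `2`-cocycle `ζ` there are integers `b_ijk` — a Čech cocycle on the non-empty
quadruple intersections — and a homogeneous element `Y` of total degree `1` of the integer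
Čech–singular double complex of `𝒰` with `(ε ζ at (0,2)) − (η b at (2,0)) = D Y`: the collating zigzag
exhibiting `b` as the Čech cocycle of the class of `ζ` (Bott–Tu Prop. 9.5; the chart-convex sets are
contractible, so the integer comparison `cechSingularEquiv` exists, and Čech `0`-cocycles of the
path-connected finite intersections are constants). [cite: BottTu1982Forms, Prop. 9.5 and Thm. 15.8] -/
theorem exists_intCech_of_intCocycle (ζ : SingularSimplex M 2 → ℤ)
    (hζ : ∀ σ : SingularSimplex M 3, ∑ i : Fin 4, (-1 : ℤ) ^ (i : ℕ) * ζ (σ.face i) = 0) :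
    ∃ (b : ι → ι → ι → ℤ) (Y : ∀ p q, CechCochain ℤ IntCoeff 𝒰.U p q),
      (∀ i j k l, (𝒰.U i ∩ 𝒰.U j ∩ 𝒰.U k ∩ 𝒰.U l).Nonempty → b j k l - b i k l + b i j l - b i j k = 0) ∧
      Y ∈ ADoubleComplex.Tn ℤ (X := CechCochain ℤ IntCoeff 𝒰.U) 1 ∧
      ADoubleComplex.single 0 2 ((cechSingularRow ℤ IntCoeff 𝒰.U).ε 2
          (toSmall ℤ IntCoeff 𝒰.U (fun _ ↦ subset_univ _) 2 (intCochain ζ))) -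
        ADoubleComplex.single 2 0 (cechZeroIncl ℤ IntCoeff 𝒰.U 2 (constCechCocycle 𝒰.U ℤ intCoeffHom b)) =
      (cechSingular ℤ IntCoeff 𝒰.U).totalD Y := by
  classical
  set U := 𝒰.U with hUdef
  -- the small cocycle of `ζ` and its Čech class under the INTEGER comparison
  set a : SmallCochain ℤ IntCoeff U 2 := toSmall ℤ IntCoeff U (fun _ ↦ subset_univ _) 2 (intCochain ζ) with ha
  have hac : a ∈ NatCochain.cocycles (cechSingularRow ℤ IntCoeff U).dA 2 :=
    toSmall_mem_cocycles U _ (cod_intCochain ζ hζ)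
  have hacyc := hacycInt 𝒰
  obtain ⟨b₀, hb₀⟩ := NatCochain.Cohomology.mk_surjective (cechZeroδ ℤ IntCoeff U) 2
    (cechSingularEquiv U hacyc 2 (NatCochain.Cohomology.mk _ 2 ⟨a, hac⟩))
  have hsmall : cechToSmall U 2 (NatCochain.Cohomology.mk _ 2 b₀) = NatCochain.Cohomology.mk _ 2 ⟨a, hac⟩ := by
    rw [← cechSingularEquiv_symm_apply U hacyc, hb₀, LinearEquiv.symm_apply_apply]
  rw [cechToSmall_mk_eq_mk_iff, ADoubleComplex.totB_succ, Submodule.mem_map] at hsmall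
  obtain ⟨Y, hY, hDY⟩ := hsmall
  -- the Čech `0`-cocycles `b₀ J` are constants
  have hconst : ∀ (J : Fin 3 → ι) {σ τ : SingularSimplex M 0},
      σ.range ⊆ Literature.AlgebraicTopology.SingularHomology.cechSet U J →
      τ.range ⊆ Literature.AlgebraicTopology.SingularHomology.cechSet U J →
      evalSimplex (b₀.1 J).1 σ = evalSimplex (b₀.1 J).1 τ := by
    intro J σ τ hσ hτ
    rw [← SingularSimplex.ofPoint_pt σ, ← SingularSimplex.ofPoint_pt τ]
    refine evalSimplex_ofPoint_eq_of_joinedIn (LinearMap.mem_ker.1 (b₀.1 J).2) ?_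
    rcases 𝒰.isPathConnected_or_empty 2 J with he | hpc
    · exact absurd (Set.subset_empty_iff.1 (he ▸ hσ)) σ.range_nonempty.ne_empty
    · exact hpc.joinedIn _ (pt_mem_of_range_subset hσ) _ (pt_mem_of_range_subset hτ)
  -- the integers `b i j k`
  set b : ι → ι → ι → ℤ := fun i j k ↦
    if h : (U i ∩ U j ∩ U k).Nonempty then
      (evalSimplex (b₀.1 ![i, j, k]).1 (SingularSimplex.ofPoint h.some)).down
    else 0 with hb
  have hmem3 : ∀ {i j k : ι} {x : M}, x ∈ U i ∩ U j ∩ U k →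
      x ∈ Literature.AlgebraicTopology.SingularHomology.cechSet U ![i, j, k] := fun {i j k x} hx ↦
    Literature.AlgebraicTopology.SingularHomology.mem_cechSet_iff.2 fun m ↦ by
      fin_cases m
      · exact hx.1.1
      · exact hx.1.2
      · exact hx.2
  have hbval : ∀ (i j k : ι) {σ : SingularSimplex M 0}
      (hσ : σ.range ⊆ Literature.AlgebraicTopology.SingularHomology.cechSet U ![i, j, k]),
      evalSimplex (b₀.1 ![i, j, k]).1 σ = ULift.up (b i j k) := by
    intro i j k σ hσ
    have hx := Literature.AlgebraicTopology.SingularHomology.mem_cechSet_iff.1 (pt_mem_of_range_subset hσ)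
    have hne : (U i ∩ U j ∩ U k).Nonempty := ⟨σ.pt, ⟨⟨hx 0, hx 1⟩, hx 2⟩⟩
    have hb' : b i j k = (evalSimplex (b₀.1 ![i, j, k]).1
        (SingularSimplex.ofPoint hne.some)).down := by
      rw [hb]
      exact dif_pos hne
    rw [hb', ULift.up_down]
    refine hconst _ hσ ?_
    rw [SingularSimplex.range_ofPoint, Set.singleton_subset_iff]
    exact hmem3 hne.some_mem
  -- `constCechCocycle b = b₀`
  have hBeq : constCechCocycle U ℤ intCoeffHom b = b₀.1 := by
    funext J
    obtain ⟨i, j, k, rfl⟩ : ∃ i j k, J = ![i, j, k] := ⟨J 0, J 1, J 2, by funext m; fin_cases m <;> rfl⟩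
    apply Subtype.ext
    refine ext_evalSimplex fun σ hσ ↦ ?_
    rw [coe_constCechCocycle, evalSimplex_intConstCochain _ _ hσ, hbval i j k hσ]
    rfl
  refine ⟨b, Y, fun i j k l hne ↦ ?_, hY, ?_⟩
  · -- the quadruple cocycle identity, from `δ b₀ = 0` evaluated at a point
    obtain ⟨x, hx⟩ := hne
    have hx4 : x ∈ Literature.AlgebraicTopology.SingularHomology.cechSet U ![i, j, k, l] :=
      Literature.AlgebraicTopology.SingularHomology.mem_cechSet_iff.2 fun m ↦ by
        fin_cases m
        · exact hx.1.1.1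
        · exact hx.1.1.2
        · exact hx.1.2
        · exact hx.2
    have hσ : (SingularSimplex.ofPoint x).range ⊆
        Literature.AlgebraicTopology.SingularHomology.cechSet U ![i, j, k, l] := by
      rw [SingularSimplex.range_ofPoint, Set.singleton_subset_iff]
      exact hx4
    have hcoc := (NatCochain.mem_cocycles_iff _).1 b₀.2
    have hev := congrArg (fun y : CechZeroCocycles ℤ IntCoeff U 3 ↦
      evalSimplex (y ![i, j, k, l]).1 (SingularSimplex.ofPoint x)) hcoc
    rw [← hBeq, coe_cechZeroδ_apply, evalSimplex_sum, Fin.sum_univ_four] at hev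
    simp only [evalSimplex_smul, evalSimplex_cres _ _ hσ, coe_constCechCocycle] at hev
    have e0 : ((![i, j, k, l] : Fin 4 → ι) ∘ Fin.succAbove 0) = ![j, k, l] := by
      funext m; fin_cases m <;> rfl
    have e1 : ((![i, j, k, l] : Fin 4 → ι) ∘ Fin.succAbove 1) = ![i, k, l] := by
      funext m; fin_cases m <;> rfl
    have e2 : ((![i, j, k, l] : Fin 4 → ι) ∘ Fin.succAbove 2) = ![i, j, l] := by
      funext m; fin_cases m <;> rfl
    have e3 : ((![i, j, k, l] : Fin 4 → ι) ∘ Fin.succAbove 3) = ![i, j, k] := by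
      funext m; fin_cases m <;> rfl
    rw [e0, e1, e2, e3] at hev
    rw [evalSimplex_intConstCochain _ _ (hσ.trans (e0 ▸
        Literature.AlgebraicTopology.SingularHomology.cechSet_subset_comp U ![i, j, k, l] (Fin.succAbove 0))),
      evalSimplex_intConstCochain _ _ (hσ.trans (e1 ▸
        Literature.AlgebraicTopology.SingularHomology.cechSet_subset_comp U ![i, j, k, l] (Fin.succAbove 1))),
      evalSimplex_intConstCochain _ _ (hσ.trans (e2 ▸
        Literature.AlgebraicTopology.SingularHomology.cechSet_subset_comp U ![i, j, k, l] (Fin.succAbove 2))),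
      evalSimplex_intConstCochain _ _ (hσ.trans (e3 ▸
        Literature.AlgebraicTopology.SingularHomology.cechSet_subset_comp U ![i, j, k, l] (Fin.succAbove 3)))]
      at hev
    rw [Pi.zero_apply, ZeroMemClass.coe_zero,
      evalSimplex_of_subset (0 : CochainOn ℤ IntCoeff
        (Literature.AlgebraicTopology.SingularHomology.cechSet U ![i, j, k, l]) 0) hσ,
      LinearMap.zero_apply] at hev
    have hev' := congrArg ULift.down hev
    simp only [Matrix.cons_val_zero, Matrix.cons_val_one, Matrix.cons_val_two, Matrix.head_cons,
      Matrix.tail_cons, intCoeffHom_apply, ULift.add_down, ULift.smul_down, smul_eq_mul, Fin.val_zero,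
      pow_zero, one_mul, Fin.val_one, pow_one, neg_one_mul, Fin.val_two, neg_one_sq,
      show ((3 : Fin 4) : ℕ) = 3 from rfl, show ((-1 : ℤ) ^ 3) = -1 by norm_num, ULift.zero_down] at hev'
    linarith
  · rw [hBeq, hDY, ADoubleComplex.RowAugmentation.coe_εTot, ADoubleComplex.RowAugmentation.coe_εTot,
      ADoubleComplex.swapₗ_single]
    rfl

end IntSide

/-! ### The real core: the Čech cocycle of a zigzag minus the integer Čech cocycle of the class -/

section Core

variable {E : Type} [NormedAddCommGroup E] [NormedSpace ℝ E] [FiniteDimensional ℝ E]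
  {M : Type} [TopologicalSpace M] [ChartedSpace E M] [IsManifold 𝓘(ℝ, E) ∞ M] [T2Space M] [CompactSpace M]
  {ι : Type*}

omit [FiniteDimensional ℝ E] [IsManifold 𝓘(ℝ, E) ∞ M] [T2Space M] [CompactSpace M] in
/-- **The real singular cocycle of an integer-valued cocycle function.** [folklore] -/
theorem d_realCochain (ζ : SingularSimplex M 2 → ℤ)
    (hζ : ∀ σ : SingularSimplex M 3, ∑ i : Fin 4, (-1 : ℤ) ^ (i : ℕ) * ζ (σ.face i) = 0) :
    (singularCochainComplex ℝ ℝ M).d 2 (2 + 1) (fun σ ↦ (ζ σ : ℝ)) = 0 := by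
  refine singularCochainComplex.ext fun σ ↦ ?_
  rw [singularCochainComplex.d_apply]
  change _ = (0 : ℝ)
  have h := congrArg (fun z : ℤ ↦ (z : ℝ)) (hζ σ)
  push_cast at h
  rw [← h]
  refine Finset.sum_congr rfl fun i _ ↦ ?_
  rw [smul_eq_mul]

omit [FiniteDimensional ℝ E] [IsManifold 𝓘(ℝ, E) ∞ M] [T2Space M] [CompactSpace M] in
/-- The real singular cocycle `σ ↦ (ζ σ : ℝ)`. [folklore] -/
def realCocycle (ζ : SingularSimplex M 2 → ℤ)
    (hζ : ∀ σ : SingularSimplex M 3, ∑ i : Fin 4, (-1 : ℤ) ^ (i : ℕ) * ζ (σ.face i) = 0) :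
    singularCochainComplex.cocycles ℝ ℝ M 2 :=
  singularCochainComplex.cocyclesMk (fun σ ↦ (ζ σ : ℝ)) (d_realCochain ζ hζ)

omit [FiniteDimensional ℝ E] [IsManifold 𝓘(ℝ, E) ∞ M] [T2Space M] [CompactSpace M] in
/-- The underlying cochain of `realCocycle ζ hζ`. [folklore] -/
@[simp]
theorem iCocycles_realCocycle (ζ : SingularSimplex M 2 → ℤ)
    (hζ : ∀ σ : SingularSimplex M 3, ∑ i : Fin 4, (-1 : ℤ) ^ (i : ℕ) * ζ (σ.face i) = 0) :
    singularCochainComplex.iCocycles ℝ ℝ M 2 (realCocycle ζ hζ) = fun σ ↦ (ζ σ : ℝ) :=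
  singularCochainComplex.iCocycles_mk _ (d_realCochain ζ hζ)

omit [FiniteDimensional ℝ E] [T2Space M] [CompactSpace M] in
/-- **The smooth real constant Čech cocycle of integers `b` satisfying the quadruple identity is a
Čech cocycle** of smooth `0`-cocycles. [cite: BottTu1982Forms, §8 (8.4)] -/
theorem cechConstCochain_int_mem_cocycles {U : ι → Set M} (hU : ∀ i, IsOpen (U i)) (b : ι → ι → ι → ℤ)
    (hb4 : ∀ i j k l, (U i ∩ U j ∩ U k ∩ U l).Nonempty → b j k l - b i k l + b i j l - b i j k = 0) :
    cechConstCochain U 𝓘(ℝ, E) hU (fun i j k ↦ (b i j k : ℝ)) ∈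
      NatCochain.cocycles (cechZeroSδ 𝓘(ℝ, E) ℝ ℝ U) 2 := by
  rw [NatCochain.mem_cocycles_iff]
  funext J
  obtain ⟨i, j, k, l, rfl⟩ : ∃ i j k l, J = ![i, j, k, l] :=
    ⟨J 0, J 1, J 2, J 3, by funext m; fin_cases m <;> rfl⟩
  apply Subtype.ext
  rw [coe_cechZeroSδ_apply]
  change _ = (0 : SCochainOn 𝓘(ℝ, E) ℝ ℝ _ 0)
  refine ext_sEvalSimplex fun σ hσ ↦ ?_
  have hx := Literature.AlgebraicTopology.SingularHomology.mem_cechSet_iff.1 (hσ.2 σ.pt_mem_range)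
  have hne : (U i ∩ U j ∩ U k ∩ U l).Nonempty := ⟨σ.pt, ⟨⟨hx 0, hx 1⟩, hx 2⟩, hx 3⟩
  have h := congrArg (fun z : ℤ ↦ (z : ℝ)) (hb4 i j k l hne)
  push_cast at h
  rw [sEvalSimplex_sum, Fin.sum_univ_four, sEvalSimplex_of_isSmoothIn (0 : SCochainOn 𝓘(ℝ, E) ℝ ℝ _ 0) hσ,
    LinearMap.zero_apply]
  simp only [sEvalSimplex_smul, sEvalSimplex_scres _ _ hσ, coe_cechConstCochain,
    sEvalSimplex_intSCochain_ofFun _ (hσ.mono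
      (Literature.AlgebraicTopology.SingularHomology.cechSet_subset_comp U ![i, j, k, l] _))]
  have e0 : ((![i, j, k, l] : Fin 4 → ι) ∘ Fin.succAbove 0) = ![j, k, l] := by
    funext m; fin_cases m <;> rfl
  have e1 : ((![i, j, k, l] : Fin 4 → ι) ∘ Fin.succAbove 1) = ![i, k, l] := by
    funext m; fin_cases m <;> rfl
  have e2 : ((![i, j, k, l] : Fin 4 → ι) ∘ Fin.succAbove 2) = ![i, j, l] := by
    funext m; fin_cases m <;> rfl
  have e3 : ((![i, j, k, l] : Fin 4 → ι) ∘ Fin.succAbove 3) = ![i, j, k] := by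
    funext m; fin_cases m <;> rfl
  simp only [Function.comp_apply] at e0 e1 e2 e3 ⊢
  simp only [show ∀ m, (![i, j, k, l] : Fin 4 → ι) (Fin.succAbove 0 m) = ![j, k, l] m from fun m ↦ congr_fun e0 m,
    show ∀ m, (![i, j, k, l] : Fin 4 → ι) (Fin.succAbove 1 m) = ![i, k, l] m from fun m ↦ congr_fun e1 m,
    show ∀ m, (![i, j, k, l] : Fin 4 → ι) (Fin.succAbove 2 m) = ![i, j, l] m from fun m ↦ congr_fun e2 m,
    show ∀ m, (![i, j, k, l] : Fin 4 → ι) (Fin.succAbove 3 m) = ![i, j, k] m from fun m ↦ congr_fun e3 m,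
    Matrix.cons_val_zero, Matrix.cons_val_one, Matrix.cons_val_two, Matrix.head_cons, Matrix.tail_cons,
    Fin.val_zero, pow_zero, Fin.val_one, pow_one, Fin.val_two, neg_one_sq,
    show ((3 : Fin 4) : ℕ) = 3 from rfl, show ((-1 : ℝ) ^ 3) = -1 by norm_num, smul_eq_mul, one_mul]
  linarith

/-- **The real core, with the class.** Let `𝒰` be a chart-convex finite cover of the compact manifold
`M`, `η` a closed smooth real `2`-form whose integration class is the class of the real cocycle of
an INTEGER-valued singular cocycle `ζ`, `b` the integer Čech cocycle of `ζ` on `𝒰` with its collating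
zigzag `Y` (`exists_intCech_of_intCocycle`), and `(α_i, f_ij, c_ijk)` a zigzag resolving `η` on `𝒰`.
Then `c − δt = b` on the nonempty triple intersections, for some constants `t_ij`.
[cite: BottTu1982Forms, Thm. 15.8 with Prop. 9.5] -/
theorem exists_sub_cechδ_eq_intCech_of_integration_eq_π (𝒰 : ChartConvexCover E M ι)
    {η : MForm 𝓘(ℝ, E) M ℝ 2} (hη : η ∈ closedSmoothForms 𝓘(ℝ, E) M ℝ 2)
    (ζ : SingularSimplex M 2 → ℤ)
    (hζ : ∀ σ : SingularSimplex M 3, ∑ i : Fin 4, (-1 : ℤ) ^ (i : ℕ) * ζ (σ.face i) = 0)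
    (hηζ : integrationDeRhamIsoFamily E M 2 (deRhamCohomology.mk ⟨η, hη⟩) =
      singularCohomology.π ℝ ℝ M 2 (realCocycle ζ hζ))
    {b : ι → ι → ι → ℤ} {Y : ∀ p q, CechCochain ℤ IntCoeff 𝒰.U p q}
    (hb4 : ∀ i j k l, (𝒰.U i ∩ 𝒰.U j ∩ 𝒰.U k ∩ 𝒰.U l).Nonempty → b j k l - b i k l + b i j l - b i j k = 0)
    (hY : Y ∈ ADoubleComplex.Tn ℤ (X := CechCochain ℤ IntCoeff 𝒰.U) 1)
    (hbY : ADoubleComplex.single 0 2 ((cechSingularRow ℤ IntCoeff 𝒰.U).ε 2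
          (toSmall ℤ IntCoeff 𝒰.U (fun _ ↦ subset_univ _) 2 (intCochain ζ))) -
        ADoubleComplex.single 2 0 (cechZeroIncl ℤ IntCoeff 𝒰.U 2 (constCechCocycle 𝒰.U ℤ intCoeffHom b)) =
      (cechSingular ℤ IntCoeff 𝒰.U).totalD Y)
    {α : ι → MForm 𝓘(ℝ, E) M ℝ 1} (hα : ∀ i, ∀ x ∈ 𝒰.U i, (α i).SmoothAt x)
    (hdα : ∀ i, ∀ x ∈ 𝒰.U i, mextDeriv (α i) x = η x)
    {f : ι → ι → M → ℝ} (hfs : ∀ i j, ∀ x ∈ 𝒰.U i ∩ 𝒰.U j, (MForm.ofFun 𝓘(ℝ, E) (f i j)).SmoothAt x)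
    (hdf : ∀ i j, ∀ x ∈ 𝒰.U i ∩ 𝒰.U j, mextDeriv (MForm.ofFun 𝓘(ℝ, E) (f i j)) x = α i x - α j x)
    {c : ι → ι → ι → ℝ} (hc : ∀ i j k, ∀ x ∈ 𝒰.U i ∩ 𝒰.U j ∩ 𝒰.U k, f i j x + f j k x - f i k x = c i j k) :
    ∃ t : ι → ι → ℝ, ∀ i j k, (𝒰.U i ∩ 𝒰.U j ∩ 𝒰.U k).Nonempty →
      c i j k - (t i j + t j k - t i k) = b i j k := by
  classical
  have hU : ∀ i, IsOpen (𝒰.U i) := 𝒰.isOpen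
  have hW : ∀ {m : ℕ} (J : Fin (m + 1) → ι), Literature.AlgebraicTopology.SingularHomology.cechSet 𝒰.U J = ∅ ∨
      ∃ (p : M) (C : Set E), Convex ℝ C ∧ C ⊆ (extChartAt 𝓘(ℝ, E) p).target ∧
        Literature.AlgebraicTopology.SingularHomology.cechSet 𝒰.U J = chartSet 𝓘(ℝ, E) p C :=
    fun J ↦ isEmptyOrChartSet_cechSet 𝒰 J
  have hs : IsSmoothForm η := ((mem_closedSmoothForms_iff η).1 hη).1
  have hcl : IsClosedForm η := ((mem_closedSmoothForms_iff η).1 hη).2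
  -- the smooth small cocycle of `ζ` and the integration cochain of `η` have the same class
  set Zsm := singSmall 𝓘(ℝ, E) 𝒰.U 2 (singularCochainComplex.iCocycles ℝ ℝ M 2 (realCocycle ζ hζ)) with hZsm
  have hZc : Zsm ∈ NatCochain.cocycles (cechSmoothSingularRow 𝓘(ℝ, E) ℝ ℝ 𝒰.U).dA 2 :=
    singSmall_mem_cocycles 𝒰.U 2 _ (singularCochainComplex.d_iCocycles 3 _)
  have hAc := intSmallCochain_mem_cocycles 𝒰.U hs hcl
  obtain ⟨W, hW'⟩ := exists_singSmall_sub_intSmall_eq_dA ⟨η, hη⟩ (realCocycle ζ hζ) hηζ 𝒰.U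
  have hcls : NatCochain.Cohomology.mk (cechSmoothSingularRow 𝓘(ℝ, E) ℝ ℝ 𝒰.U).dA 2 ⟨Zsm, hZc⟩ =
      NatCochain.Cohomology.mk (cechSmoothSingularRow 𝓘(ℝ, E) ℝ ℝ 𝒰.U).dA 2 ⟨intSmallCochain 𝒰.U 2 η, hAc⟩ := by
    rw [NatCochain.Cohomology.mk_eq_mk_iff, NatCochain.mem_coboundaries_succ_iff]
    exact ⟨W, hW'.symm⟩
  -- the smooth comparison isomorphism: `[∫η] ↦ [(c)]`
  have hacyc := hacyc_of_isEmptyOrChartSet (R := ℝ) (N := ℝ) 𝒰.U hW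
  have hint := cechSmoothSingularEquiv_intSmall_eq hU hacyc hs hcl hα hdα hfs hdf hc
  -- the smooth real constant Čech cocycle `(b)` and the transferred collating zigzag: `[Z] ↦ [(b)]`
  set bR := cechConstCochain 𝒰.U 𝓘(ℝ, E) hU (fun i j k ↦ (b i j k : ℝ)) with hbR
  have hbRc := cechConstCochain_int_mem_cocycles (E := E) hU b hb4
  have L1 : toSmoothRealCech (E := E) 𝒰.U 0 2 ((cechSingularRow ℤ IntCoeff 𝒰.U).ε 2
      (toSmall ℤ IntCoeff 𝒰.U (fun _ ↦ subset_univ _) 2 (intCochain ζ))) =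
      (cechSmoothSingularRow 𝓘(ℝ, E) ℝ ℝ 𝒰.U).ε 2 Zsm := by
    funext J
    rw [toSmoothRealCech_apply]
    refine ext_sEvalSimplex fun σ hσ ↦ ?_
    rw [sEvalSimplex_toSmoothReal _ hσ, evalSimplex_of_subset _ hσ.2, cechSingularRow_ε_apply_elemChain,
      toSmall_apply, sEvalSimplex_of_isSmoothIn _ hσ, cechSmoothSingularRow_ε_apply_sElemChain, hZsm,
      singSmall_apply_single, iCocycles_realCocycle]
    have h1 : (intCochain ζ) (((Subcomplex.incl (smallSub_le_chainsInSub ℤ ℤ (fun _ ↦ subset_univ _) (U := 𝒰.U))).f 2).hom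
        ⟨Finsupp.single σ 1, chainsInSub_cechSet_le_smallSub 𝒰.U J 2 (single_mem_chainsIn ℤ ℤ hσ.2 1)⟩) =
        evalSimplex (intCochain ζ) σ := by
      rw [evalSimplex_of_subset _ (subset_univ _)]
      rfl
    rw [h1, evalSimplex_intCochain]
  have L2 : toSmoothRealCech (E := E) 𝒰.U 2 0 (cechZeroIncl ℤ IntCoeff 𝒰.U 2 (constCechCocycle 𝒰.U ℤ intCoeffHom b)) =
      cechZeroSIncl 𝓘(ℝ, E) ℝ ℝ 𝒰.U 2 bR := by
    funext J
    rw [toSmoothRealCech_apply]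
    refine ext_sEvalSimplex fun σ hσ ↦ ?_
    change sEvalSimplex (toSmoothReal _ 0 (constCechCocycle 𝒰.U ℤ intCoeffHom b J).1) σ = sEvalSimplex (bR J).1 σ
    rw [sEvalSimplex_toSmoothReal _ hσ, coe_constCechCocycle, evalSimplex_intConstCochain _ _ hσ.2,
      hbR, coe_cechConstCochain, sEvalSimplex_intSCochain_ofFun _ hσ, intCoeffHom_apply]
  have hzig : ADoubleComplex.single 0 2 ((cechSmoothSingularRow 𝓘(ℝ, E) ℝ ℝ 𝒰.U).ε 2 Zsm) -
      ADoubleComplex.single 2 0 ((cechSmoothSingularCol 𝓘(ℝ, E) ℝ ℝ 𝒰.U).ε 2 bR) =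
      (cechSmoothSingular 𝓘(ℝ, E) ℝ ℝ 𝒰.U).totalD (toSmoothRealTot (E := E) 𝒰.U Y) := by
    rw [← toSmoothRealTot_totalD, ← hbY, toSmoothRealTot_sub, toSmoothRealTot_single, toSmoothRealTot_single,
      L1, L2]
    rfl
  have hstair : cechSmoothSingularEquiv 𝒰.U hacyc 2
      (NatCochain.Cohomology.mk (cechSmoothSingularRow 𝓘(ℝ, E) ℝ ℝ 𝒰.U).dA 2 ⟨Zsm, hZc⟩) =
      NatCochain.Cohomology.mk (cechZeroSδ 𝓘(ℝ, E) ℝ ℝ 𝒰.U) 2 ⟨bR, hbRc⟩ :=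
    ADoubleComplex.rowColEquiv_mk_eq_mk_of_totalD (cechSmoothSingularRow 𝓘(ℝ, E) ℝ ℝ 𝒰.U)
      (cechSmoothSingularCol 𝓘(ℝ, E) ℝ ℝ 𝒰.U) (cechSmoothSingular_rowExact 𝒰.U) (cechSmoothSingularRow_exact 𝒰.U)
      (cechSmoothSingular_colExact 𝒰.U hacyc) (cechSmoothSingularCol_exact 𝒰.U) (n := 1) ⟨Zsm, hZc⟩ ⟨bR, hbRc⟩
      (toSmoothRealTot (E := E) 𝒰.U Y) (toSmoothRealTot_mem_Tn 𝒰.U hY) hzig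
  -- `(c) - (b)` is a Čech coboundary of smooth `0`-cocycles
  have hcb : NatCochain.Cohomology.mk (cechZeroSδ 𝓘(ℝ, E) ℝ ℝ 𝒰.U) 2
      ⟨cechConstCochain 𝒰.U 𝓘(ℝ, E) hU c, cechConstCochain_mem_cocycles hU hc⟩ =
      NatCochain.Cohomology.mk (cechZeroSδ 𝓘(ℝ, E) ℝ ℝ 𝒰.U) 2 ⟨bR, hbRc⟩ := by
    rw [← hint, ← hstair, hcls]
  rw [NatCochain.Cohomology.mk_eq_mk_iff, NatCochain.mem_coboundaries_succ_iff] at hcb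
  obtain ⟨a', ha'⟩ := hcb
  -- the constants: values of `a'_{ij}` at a point of `U_i ∩ U_j`
  set A2 : (Fin 2 → ι) → ℝ := fun K ↦ if h : (𝒰.U (K 0) ∩ 𝒰.U (K 1)).Nonempty then
    sEvalSimplex (a' K : SCochainOn 𝓘(ℝ, E) ℝ ℝ (Literature.AlgebraicTopology.SingularHomology.cechSet 𝒰.U K) 0)
      (SingularSimplex.constAt h.some 0) else 0 with hA2
  have hA2val : ∀ (K : Fin 2 → ι) {x : M} (hx : x ∈ 𝒰.U (K 0) ∩ 𝒰.U (K 1)),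
      sEvalSimplex (a' K : SCochainOn 𝓘(ℝ, E) ℝ ℝ (Literature.AlgebraicTopology.SingularHomology.cechSet 𝒰.U K) 0)
        (SingularSimplex.constAt x 0) = A2 K := by
    intro K x hx
    have hne : (𝒰.U (K 0) ∩ 𝒰.U (K 1)).Nonempty := ⟨x, hx⟩
    rw [hA2]
    simp only [dif_pos hne]
    have hK : ∀ {y : M}, y ∈ 𝒰.U (K 0) ∩ 𝒰.U (K 1) → y ∈ Literature.AlgebraicTopology.SingularHomology.cechSet 𝒰.U K :=
      fun {y} hy ↦ Literature.AlgebraicTopology.SingularHomology.mem_cechSet_iff.2 fun m ↦ by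
        fin_cases m
        · exact hy.1
        · exact hy.2
    exact sEvalSimplex_eq_of_mem_zeroSCocycles (hW K) (a' K).2 (isSmoothIn_constAt_of_mem (hK hx))
      (isSmoothIn_constAt_of_mem (hK hne.some_mem))
  refine ⟨fun i j ↦ A2 ![i, j], fun i j k hne ↦ ?_⟩
  change c i j k - (A2 ![i, j] + A2 ![j, k] - A2 ![i, k]) = b i j k
  obtain ⟨x, hx⟩ := hne
  have hx3 : x ∈ Literature.AlgebraicTopology.SingularHomology.cechSet 𝒰.U ![i, j, k] :=
    mem_cechSet_vec_three.2 ⟨hx.1.1, hx.1.2, hx.2⟩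
  have hsx := isSmoothIn_constAt_of_mem (E := E) hx3
  -- evaluate `δ a' = (c) - (b)` at the point `x` of `U_i ∩ U_j ∩ U_k`
  have hev := congrArg (fun y : CechZeroSCocycles 𝓘(ℝ, E) ℝ ℝ 𝒰.U 2 ↦
    sEvalSimplex (y ![i, j, k] : SCochainOn 𝓘(ℝ, E) ℝ ℝ (Literature.AlgebraicTopology.SingularHomology.cechSet 𝒰.U ![i, j, k]) 0)
      (SingularSimplex.constAt x 0)) ha'
  simp only at hev
  rw [coe_cechZeroSδ_apply, sEvalSimplex_sum, Fin.sum_univ_three] at hev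
  simp only [sEvalSimplex_smul, sEvalSimplex_scres _ _ hsx, Fin.val_zero, Fin.val_one, Fin.val_two, pow_zero,
    pow_one, neg_one_sq, one_smul, smul_eq_mul, one_mul, neg_mul, Pi.sub_apply,
    Submodule.coe_sub, sEvalSimplex_sub, coe_cechConstCochain, sEvalSimplex_intSCochain_ofFun _ hsx, hbR] at hev
  -- the faces of `(i, j, k)`
  have e0 : ((![i, j, k] : Fin 3 → ι) ∘ Fin.succAbove 0) = ![j, k] := by
    funext m; fin_cases m <;> rfl
  have e1 : ((![i, j, k] : Fin 3 → ι) ∘ Fin.succAbove 1) = ![i, k] := by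
    funext m; fin_cases m <;> rfl
  have e2 : ((![i, j, k] : Fin 3 → ι) ∘ Fin.succAbove 2) = ![i, j] := by
    funext m; fin_cases m <;> rfl
  rw [e0, e1, e2, hA2val ![j, k] ⟨hx.1.2, hx.2⟩, hA2val ![i, k] ⟨hx.1.1, hx.2⟩, hA2val ![i, j] ⟨hx.1.1, hx.1.2⟩] at hev
  simp only [Matrix.cons_val_zero, Matrix.cons_val_one, Matrix.cons_val_two, Matrix.head_cons,
    Matrix.tail_cons] at hev
  linarith

end Core

/-! ### The complex statement -/

section Complex

variable {E : Type} [NormedAddCommGroup E] [NormedSpace ℂ E] [FiniteDimensional ℝ E]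
  {M : Type} [TopologicalSpace M] [ChartedSpace E M] [IsManifold 𝓘(ℝ, E) ∞ M] [T2Space M] [CompactSpace M]
  {ι : Type*}

omit [FiniteDimensional ℝ E] [IsManifold 𝓘(ℝ, E) ∞ M] [T2Space M] [CompactSpace M] in
/-- The complex cochain `σ ↦ (ζ σ : ℂ)` of an integer-valued cocycle function is a cocycle.
[folklore] -/
theorem d_complexCochain (ζ : SingularSimplex M 2 → ℤ)
    (hζ : ∀ σ : SingularSimplex M 3, ∑ i : Fin 4, (-1 : ℤ) ^ (i : ℕ) * ζ (σ.face i) = 0) :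
    (singularCochainComplex ℂ ℂ M).d 2 (2 + 1) (fun σ ↦ (ζ σ : ℂ)) = 0 := by
  refine singularCochainComplex.ext fun σ ↦ ?_
  rw [singularCochainComplex.d_apply]
  change _ = (0 : ℂ)
  have h := congrArg (fun z : ℤ ↦ (z : ℂ)) (hζ σ)
  push_cast at h
  rw [← h]
  refine Finset.sum_congr rfl fun i _ ↦ ?_
  rw [smul_eq_mul]

omit [FiniteDimensional ℝ E] [IsManifold 𝓘(ℝ, E) ∞ M] [T2Space M] [CompactSpace M] in
/-- **The complex singular cocycle `σ ↦ (ζ σ : ℂ)` of an integer-valued cocycle function.**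
[folklore] -/
def complexCocycle (ζ : SingularSimplex M 2 → ℤ)
    (hζ : ∀ σ : SingularSimplex M 3, ∑ i : Fin 4, (-1 : ℤ) ^ (i : ℕ) * ζ (σ.face i) = 0) :
    singularCochainComplex.cocycles ℂ ℂ M 2 :=
  singularCochainComplex.cocyclesMk (fun σ ↦ (ζ σ : ℂ)) (d_complexCochain ζ hζ)

omit [FiniteDimensional ℝ E] [IsManifold 𝓘(ℝ, E) ∞ M] [T2Space M] [CompactSpace M] in
/-- The underlying cochain of `complexCocycle ζ hζ`. [folklore] -/
@[simp]
theorem iCocycles_complexCocycle (ζ : SingularSimplex M 2 → ℤ)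
    (hζ : ∀ σ : SingularSimplex M 3, ∑ i : Fin 4, (-1 : ℤ) ^ (i : ℕ) * ζ (σ.face i) = 0) :
    singularCochainComplex.iCocycles ℂ ℂ M 2 (complexCocycle ζ hζ) = fun σ ↦ (ζ σ : ℂ) :=
  singularCochainComplex.iCocycles_mk _ (d_complexCochain ζ hζ)

omit [FiniteDimensional ℝ E] [IsManifold 𝓘(ℝ, E) ∞ M] [T2Space M] [CompactSpace M] in
/-- The real part of the complex cocycle of `ζ` is its real cocycle. [folklore] -/
theorem coeffCocycle_re_complexCocycle (ζ : SingularSimplex M 2 → ℤ)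
    (hζ : ∀ σ : SingularSimplex M 3, ∑ i : Fin 4, (-1 : ℤ) ^ (i : ℕ) * ζ (σ.face i) = 0) :
    coeffCocycle (R := ℂ) (S := ℝ) Complex.reAddGroupHom 2 (complexCocycle ζ hζ) =
      realCocycle ζ hζ := by
  refine singularCochainComplex.cocycles_ext ?_
  rw [iCocycles_coeffCocycle, iCocycles_complexCocycle, realCocycle, singularCochainComplex.iCocycles_mk]
  funext σ
  rw [coeffCochain_apply]
  change ((ζ σ : ℂ)).re = (ζ σ : ℝ)
  exact Complex.intCast_re _

/-- **The Čech integrality step, with the class.** On a finite chart-convex cover `𝒰` of a compact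
`C^∞` manifold `M` charted on the complex normed space `E`, let `θ` be a closed smooth complex
`2`-form whose class under the complexified integration isomorphism of de Rham's theorem is the class
of the complex cocycle of an INTEGER-valued singular cocycle `ζ`; let `b` be the integer Čech cocycle of
`ζ` on `𝒰` with its collating zigzag `Y` (`exists_intCech_of_intCocycle`); and let `θ = dα_i`,
`α_i − α_j = df_ij`, `f_ij + f_jk − f_ik = c_ijk` be a zigzag. Then `c_ijk − (a_ij + a_jk − a_ik) = b_ijk`
on the nonempty triple intersections, for some constants `a_ij ∈ ℂ` (real parts: the real core with
the class; imaginary parts: the zero cocycle). [cite: BottTu1982Forms, Thm. 15.8 with Prop. 9.5] -/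
theorem exists_sub_cechδ_eq_intCech_of_complexify_eq_π (𝒰 : ChartConvexCover E M ι)
    (θ : MForm 𝓘(ℝ, E) M ℂ 2) (hθ : θ ∈ cclosedSmoothForms E M 2)
    (ζ : SingularSimplex M 2 → ℤ)
    (hζ : ∀ σ : SingularSimplex M 3, ∑ i : Fin 4, (-1 : ℤ) ^ (i : ℕ) * ζ (σ.face i) = 0)
    (hθζ : (integrationDeRhamIsoFamily E).complexify M 2 (complexDeRhamCohomology.mk E M 2 ⟨θ, hθ⟩) =
      singularCohomology.π ℂ ℂ M 2 (complexCocycle ζ hζ))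
    {b : ι → ι → ι → ℤ} {Y : ∀ p q, CechCochain ℤ IntCoeff 𝒰.U p q}
    (hb4 : ∀ i j k l, (𝒰.U i ∩ 𝒰.U j ∩ 𝒰.U k ∩ 𝒰.U l).Nonempty → b j k l - b i k l + b i j l - b i j k = 0)
    (hY : Y ∈ ADoubleComplex.Tn ℤ (X := CechCochain ℤ IntCoeff 𝒰.U) 1)
    (hbY : ADoubleComplex.single 0 2 ((cechSingularRow ℤ IntCoeff 𝒰.U).ε 2
          (toSmall ℤ IntCoeff 𝒰.U (fun _ ↦ subset_univ _) 2 (intCochain ζ))) -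
        ADoubleComplex.single 2 0 (cechZeroIncl ℤ IntCoeff 𝒰.U 2 (constCechCocycle 𝒰.U ℤ intCoeffHom b)) =
      (cechSingular ℤ IntCoeff 𝒰.U).totalD Y)
    (α : ι → MForm 𝓘(ℝ, E) M ℂ 1) (hαs : ∀ i, α i ∈ smoothFormsOn 𝓘(ℝ, E) ℂ (𝒰.U i) 1)
    (hdα : ∀ i, ∀ x ∈ 𝒰.U i, mextDeriv (α i) x = θ x)
    (f : ι → ι → M → ℂ)
    (hfs : ∀ i j, ∀ x ∈ 𝒰.U i ∩ 𝒰.U j, (MForm.ofFun 𝓘(ℝ, E) (f i j)).SmoothAt x)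
    (hdf : ∀ i j, ∀ x ∈ 𝒰.U i ∩ 𝒰.U j, mextDeriv (MForm.ofFun 𝓘(ℝ, E) (f i j)) x = α i x - α j x)
    (c : ι → ι → ι → ℂ)
    (hc : ∀ i j k, ∀ x ∈ 𝒰.U i ∩ 𝒰.U j ∩ 𝒰.U k, f i j x + f j k x - f i k x = c i j k) :
    ∃ a : ι → ι → ℂ, ∀ i j k, (𝒰.U i ∩ 𝒰.U j ∩ 𝒰.U k).Nonempty →
      c i j k - (a i j + a j k - a i k) = b i j k := by
  classical
  set z := complexCocycle ζ hζ with hz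
  set e := integrationDeRhamIsoFamily E with he
  -- the integration classes of `Re θ`, `Im θ` are the classes of `re ∘ z = ζ_ℝ`, `im ∘ z = 0`
  have hζre : e M 2 (deRhamCohomology.mk ⟨θ.re, re_mem_closedSmoothForms hθ⟩) =
      singularCohomology.π ℝ ℝ M 2 (realCocycle ζ hζ) := by
    have h : reClass M 2 (e.complexify M 2 (complexDeRhamCohomology.mk E M 2 ⟨θ, hθ⟩)) =
        singularCohomology.π ℝ ℝ M 2 (coeffCocycle (R := ℂ) Complex.reAddGroupHom 2 z) := by
      rw [hθζ]
      exact reClass_π z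
    rw [complexify_apply, reClass_complexifyFun, complexDeRhamCohomology.re_mk, hz,
      coeffCocycle_re_complexCocycle] at h
    exact h
  have hζim : e M 2 (deRhamCohomology.mk ⟨θ.im, im_mem_closedSmoothForms hθ⟩) =
      singularCohomology.π ℝ ℝ M 2 (coeffCocycle (R := ℂ) Complex.imAddGroupHom 2 z) := by
    have h : imClass M 2 (e.complexify M 2 (complexDeRhamCohomology.mk E M 2 ⟨θ, hθ⟩)) =
        singularCohomology.π ℝ ℝ M 2 (coeffCocycle (R := ℂ) Complex.imAddGroupHom 2 z) := by
      rw [hθζ]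
      exact imClass_π z
    rw [complexify_apply, imClass_complexifyFun, complexDeRhamCohomology.im_mk] at h
    exact h
  have hvim : ∀ σ, singularCochainComplex.iCocycles ℝ ℝ M 2 (coeffCocycle (R := ℂ) Complex.imAddGroupHom 2 z) σ ∈
      (⊥ : AddSubgroup ℝ) := fun σ ↦ by
    rw [iCocycles_coeffCocycle, coeffCochain_apply, hz, iCocycles_complexCocycle]
    change ((ζ σ : ℂ)).im ∈ (⊥ : AddSubgroup ℝ)
    rw [Complex.intCast_im]
    exact AddSubgroup.mem_bot.2 rfl
  -- the real and imaginary zigzags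
  have hαre : ∀ i, ∀ x ∈ 𝒰.U i, (α i).re.SmoothAt x := fun i x hx ↦ smoothAt_re ((hαs i).1 x hx)
  have hαim : ∀ i, ∀ x ∈ 𝒰.U i, (α i).im.SmoothAt x := fun i x hx ↦ smoothAt_im ((hαs i).1 x hx)
  have hdαre : ∀ i, ∀ x ∈ 𝒰.U i, mextDeriv (α i).re x = θ.re x := fun i x hx ↦ by
    rw [← re_mextDeriv_apply_of_smoothAt ((hαs i).1 x hx)]
    change Complex.reCLM.compContinuousAlternatingMap (mextDeriv (α i) x) = _
    rw [hdα i x hx]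
    rfl
  have hdαim : ∀ i, ∀ x ∈ 𝒰.U i, mextDeriv (α i).im x = θ.im x := fun i x hx ↦ by
    rw [← im_mextDeriv_apply_of_smoothAt ((hαs i).1 x hx)]
    change Complex.imCLM.compContinuousAlternatingMap (mextDeriv (α i) x) = _
    rw [hdα i x hx]
    rfl
  have hfsre : ∀ i j, ∀ x ∈ 𝒰.U i ∩ 𝒰.U j, (MForm.ofFun 𝓘(ℝ, E) fun y ↦ (f i j y).re).SmoothAt x :=
    fun i j x hx ↦ by rw [← ofFun_re]; exact smoothAt_re (hfs i j x hx)
  have hfsim : ∀ i j, ∀ x ∈ 𝒰.U i ∩ 𝒰.U j, (MForm.ofFun 𝓘(ℝ, E) fun y ↦ (f i j y).im).SmoothAt x :=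
    fun i j x hx ↦ by rw [← ofFun_im]; exact smoothAt_im (hfs i j x hx)
  have hdfre : ∀ i j, ∀ x ∈ 𝒰.U i ∩ 𝒰.U j,
      mextDeriv (MForm.ofFun 𝓘(ℝ, E) fun y ↦ (f i j y).re) x = (α i).re x - (α j).re x := fun i j x hx ↦ by
    rw [← ofFun_re, ← re_mextDeriv_apply_of_smoothAt (hfs i j x hx)]
    ext v
    simp [MForm.re_apply, hdf i j x hx]
  have hdfim : ∀ i j, ∀ x ∈ 𝒰.U i ∩ 𝒰.U j,
      mextDeriv (MForm.ofFun 𝓘(ℝ, E) fun y ↦ (f i j y).im) x = (α i).im x - (α j).im x := fun i j x hx ↦ by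
    rw [← ofFun_im, ← im_mextDeriv_apply_of_smoothAt (hfs i j x hx)]
    ext v
    simp [MForm.im_apply, hdf i j x hx]
  have hcre : ∀ i j k, ∀ x ∈ 𝒰.U i ∩ 𝒰.U j ∩ 𝒰.U k,
      (f i j x).re + (f j k x).re - (f i k x).re = (c i j k).re := fun i j k x hx ↦ by
    have h := congrArg Complex.re (hc i j k x hx)
    simpa only [Complex.sub_re, Complex.add_re] using h
  have hcim : ∀ i j k, ∀ x ∈ 𝒰.U i ∩ 𝒰.U j ∩ 𝒰.U k,
      (f i j x).im + (f j k x).im - (f i k x).im = (c i j k).im := fun i j k x hx ↦ by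
    have h := congrArg Complex.im (hc i j k x hx)
    simpa only [Complex.sub_im, Complex.add_im] using h
  -- real parts: the real core with the class; imaginary parts: the zero cocycle
  obtain ⟨ar, har⟩ := exists_sub_cechδ_eq_intCech_of_integration_eq_π 𝒰 (re_mem_closedSmoothForms hθ) ζ hζ hζre
    hb4 hY hbY hαre hdαre hfsre hdfre hcre
  obtain ⟨ai, hai⟩ := exists_sub_cechδ_mem_of_integration_eq_π 𝒰 (⊥ : AddSubgroup ℝ)
    (im_mem_closedSmoothForms hθ) _ hζim hvim hαim hdαim hfsim hdfim hcim
  refine ⟨fun i j ↦ (ar i j : ℂ) + (ai i j : ℂ) * Complex.I, fun i j k hne ↦ ?_⟩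
  have hn : (c i j k).re - (ar i j + ar j k - ar i k) = b i j k := har i j k hne
  have h0 : (c i j k).im - (ai i j + ai j k - ai i k) = 0 := by
    simpa using (AddSubgroup.mem_bot).1 (hai i j k hne)
  apply Complex.ext
  · simp only [Complex.sub_re, Complex.add_re, Complex.mul_re, Complex.ofReal_re, Complex.ofReal_im,
      Complex.I_re, Complex.I_im, mul_zero, mul_one, sub_zero, add_zero, Complex.intCast_re]
    linarith
  · simp only [Complex.sub_im, Complex.add_im, Complex.mul_im, Complex.ofReal_re, Complex.ofReal_im,
      Complex.I_re, Complex.I_im, mul_zero, mul_one, zero_add, add_zero, Complex.intCast_im]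
    linarith

end Complex

end Literature.AlgebraicGeometry.HodgeTheory

end
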